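import Literature.NumberTheory.Automorphic.AdelicGLnGlueProofs
import Mathlib.Analysis.Matrix.Order
import Mathlib.Analysis.Convex.Basic
import HarnessLib

/-!
# The cone model of `GL_n(K ⊗ ℝ)` (stub `stub_coneModel` of line `Sketch`)

Crux `HeckeEigenvalueField` (stmt-Langlands-13632).  For a number field `K` let
`K_∞ = K ⊗_ℚ ℝ = mixedSpace K = ℝ^{r₁} × ℂ^{r₂}` (a commutative real `*`-algebra: `star` is the
identity on the `ℝ`-factors and complex conjugation on the `ℂ`-factors) and let
`X ⊆ M_n(K_∞)` be the CONE of matrices `H` whose evaluation `H_w = H.map (eval_w)` at every real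
place `w` is a positive definite real symmetric matrix and at every complex place a positive
definite Hermitian matrix.  `GL_n(K_∞)` acts on `X` through `g • H = g H gᴴ`; this is the model
`GL_n(K_∞)/K_∞ ≅ X` of the symmetric space used in the reduction theory of `GL_n(𝒪_K)`
(Borel, *Introduction aux groupes arithmétiques* (1969), §12 for `K = ℚ`; Borel–Serre (1973), §11).
The registered stub `stub_coneModel` records the four structural facts about `X` needed by the
Čech-nerve proof of the Borel–Serre finite-dimensionality theorem:

1. transitivity with base point `1`: every `H ∈ X` is `g gᴴ` for some `g ∈ GL_n(K_∞)`
   (place by place `H_w = B_w B_wᴴ` with `B_w` invertible — over `ℝ` and `ℂ` a positive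
   definite matrix is `B star B` in the C⋆-algebra `M_n` (Mathlib
   `CStarAlgebra.nonneg_iff_eq_mul_star_self`), and `B` is a unit because `H_w` is
   (Dedekind-finiteness of `M_n`); the `B_w` are glued into a matrix over `K_∞` whose
   determinant is a unit place by place);
2. the stabiliser of `1` is `K_∞ = Kinf n K`: `g gᴴ = 1 ↔ gᴴ g = 1 ↔ g ∈ U(n, K_∞) = Kinf n K`
   (`Kinf_eq_unitarySubgroupGL`, `mem_unitarySubgroupGL_iff`);
3. invariance of `X`: `(g H gᴴ)_w = g_w H_w g_wᴴ` is positive definite with `H_w`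
   (Mathlib `Matrix.PosDef.mul_mul_conjTranspose_same`, `g_w` being a unit);
4. convexity of `X`: `(a H + b H')_w = a H_w + b H'_w` is positive definite for `a, b > 0`
   (Mathlib `Matrix.PosDef.smul`, `Matrix.PosDef.add`).

Everything is reduced to the places by the evaluation ring homomorphisms
`mixedSpaceEvalReal K w : K_∞ →+* ℝ`, `mixedSpaceEvalComplex K w : K_∞ →+* ℂ`, which commute with
`star` and with the real scalar action (definitionally), and by `mixedSpace_matrix_ext`
(`AdelicGLnGlue`).

## References

* A. Borel, *Introduction aux groupes arithmétiques*, Hermann (1969), §12 [Borel1969].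
* A. Borel, J.-P. Serre, *Corners and arithmetic groups*, Comment. Math. Helv. 48 (1973), §11
  [BorelSerre1973].
-/

noncomputable section

set_option linter.dupNamespace false -- project-wide: `Summit.Langlands.Langlands` is the mandated namespace

open scoped ComplexOrder Matrix
open NumberField NumberField.mixedEmbedding Literature.NumberTheory.Automorphic

namespace Summit.Langlands.Langlands.Theorems.HeckeEigenvalueField.Res

/-! ### One place: positive definite matrices over `ℝ` or `ℂ` -/

section OnePlace

open scoped MatrixOrder

/-- **Cholesky-type factorisation at one place**: a positive definite matrix `A` over `𝕜 = ℝ` or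
`ℂ` is `B Bᴴ` for an invertible `B` (in the C⋆-algebra `M_m(𝕜)` a nonnegative element is
`B star B`; `B` is a unit since `A` is, `M_m(𝕜)` being Dedekind-finite). [folklore] -/
private theorem exists_isUnit_mul_conjTranspose_eq {𝕜 : Type*} [RCLike 𝕜] {m : Type*}
    [Fintype m] [DecidableEq m] {A : Matrix m m 𝕜} (hA : A.PosDef) :
    ∃ B : Matrix m m 𝕜, IsUnit B ∧ B * Bᴴ = A := by
  obtain ⟨B, hB⟩ := CStarAlgebra.nonneg_iff_eq_mul_star_self.mp hA.posSemidef.nonneg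
  refine ⟨B, ?_, ?_⟩
  · have hu : IsUnit A := hA.isUnit
    rw [hB] at hu
    exact isUnit_of_mul_isUnit_left hu
  · rw [hB, Matrix.star_eq_conjTranspose]

/-- **Convex combinations at one place**: `a A + b B` is positive definite for `A`, `B` positive
definite over `𝕜 = ℝ` or `ℂ` and real `a, b > 0`. [folklore] -/
private theorem posDef_smul_add_smul {𝕜 : Type*} [RCLike 𝕜] {m : Type*}
    {A B : Matrix m m 𝕜} (hA : A.PosDef) (hB : B.PosDef) {a b : ℝ} (ha : 0 < a) (hb : 0 < b) :
    (a • A + b • B).PosDef :=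
  (hA.smul ha).add (hB.smul hb)

end OnePlace

/-- **Invariance at one place**: `B A Bᴴ` is positive definite for `A` positive definite and `B`
a unit. [folklore] -/
private theorem posDef_mul_mul_conjTranspose {R : Type*} [CommRing R] [PartialOrder R]
    [StarRing R] {m : Type*} [Fintype m] [DecidableEq m] {A B : Matrix m m R} (hA : A.PosDef)
    (hB : IsUnit B) : (B * A * Bᴴ).PosDef :=
  hA.mul_mul_conjTranspose_same (Matrix.vecMul_injective_of_isUnit hB)

/-! ### Over `K_∞ = mixedSpace K`, place by place -/

section MixedSpace

variable (n : ℕ) (K : Type) [Field K]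

/-- **(i) Transitivity**: a matrix over `K_∞` which is positive definite at every place is `g gᴴ`
for some `g ∈ GL_n(K_∞)` (glue the place-wise factorisations; the glued matrix has unit
determinant place by place). [cite: Borel1969, §12] -/
private theorem coneModel_transitive (H : Matrix (Fin n) (Fin n) (mixedSpace K))
    (hR : ∀ w, (H.map (mixedSpaceEvalReal K w)).PosDef)
    (hC : ∀ w, (H.map (mixedSpaceEvalComplex K w)).PosDef) :
    ∃ g : GL (Fin n) (mixedSpace K),
      (g : Matrix (Fin n) (Fin n) (mixedSpace K)) *
        (g : Matrix (Fin n) (Fin n) (mixedSpace K))ᴴ = H := by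
  choose B hBu hB using fun w => exists_isUnit_mul_conjTranspose_eq (hR w)
  choose C hCu hC' using fun w => exists_isUnit_mul_conjTranspose_eq (hC w)
  let g₀ : Matrix (Fin n) (Fin n) (mixedSpace K) :=
    Matrix.of fun i j => (fun w => B w i j, fun w => C w i j)
  have hgR : ∀ w, g₀.map (mixedSpaceEvalReal K w) = B w := fun w => rfl
  have hgC : ∀ w, g₀.map (mixedSpaceEvalComplex K w) = C w := fun w => rfl
  have hu : IsUnit g₀ := by
    rw [Matrix.isUnit_iff_isUnit_det, Prod.isUnit_iff, Pi.isUnit_iff, Pi.isUnit_iff]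
    refine ⟨fun w => ?_, fun w => ?_⟩
    · rw [← mixedSpaceEvalReal_apply, RingHom.map_det, RingHom.mapMatrix_apply, hgR,
        ← Matrix.isUnit_iff_isUnit_det]
      exact hBu w
    · rw [← mixedSpaceEvalComplex_apply, RingHom.map_det, RingHom.mapMatrix_apply, hgC,
        ← Matrix.isUnit_iff_isUnit_det]
      exact hCu w
  refine ⟨hu.unit, ?_⟩
  rw [hu.unit_spec]
  refine mixedSpace_matrix_ext n K (fun w => ?_) (fun w => ?_)
  · rw [Matrix.map_mul, Matrix.conjTranspose_map (mixedSpaceEvalReal K w) (fun _ => rfl), hgR, hB]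
  · rw [Matrix.map_mul, Matrix.conjTranspose_map (mixedSpaceEvalComplex K w) (fun _ => rfl), hgC,
      hC']

/-- **(ii) The stabiliser of the base point**: `g gᴴ = 1 ↔ g ∈ K_∞ = Kinf n K`
(`Kinf n K = U(n, K_∞)` and `g gᴴ = 1 ↔ gᴴ g = 1` for square matrices over the commutative ring
`K_∞`). [folklore] -/
private theorem coneModel_stabilizer [NumberField K] (g : GL (Fin n) (mixedSpace K)) :
    (g : Matrix (Fin n) (Fin n) (mixedSpace K)) *
        (g : Matrix (Fin n) (Fin n) (mixedSpace K))ᴴ = 1 ↔ g ∈ Kinf n K := by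
  classical
  rw [Kinf_eq_unitarySubgroupGL, mem_unitarySubgroupGL_iff, Matrix.star_eq_conjTranspose,
    mul_eq_one_comm]

/-- **(iii) Invariance of the cone**: if `H` is positive definite at every place then so is
`g H gᴴ` for `g ∈ GL_n(K_∞)` (`(g H gᴴ)_w = g_w H_w g_wᴴ` with `g_w` a unit).
[cite: Borel1969, §12] -/
private theorem coneModel_invariant (g : GL (Fin n) (mixedSpace K))
    (H : Matrix (Fin n) (Fin n) (mixedSpace K))
    (hR : ∀ w, (H.map (mixedSpaceEvalReal K w)).PosDef)
    (hC : ∀ w, (H.map (mixedSpaceEvalComplex K w)).PosDef) :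
    (∀ w, (((g : Matrix (Fin n) (Fin n) (mixedSpace K)) * H *
      (g : Matrix (Fin n) (Fin n) (mixedSpace K))ᴴ).map (mixedSpaceEvalReal K w)).PosDef) ∧
    (∀ w, (((g : Matrix (Fin n) (Fin n) (mixedSpace K)) * H *
      (g : Matrix (Fin n) (Fin n) (mixedSpace K))ᴴ).map (mixedSpaceEvalComplex K w)).PosDef) := by
  refine ⟨fun w => ?_, fun w => ?_⟩
  · rw [Matrix.map_mul, Matrix.map_mul,
      Matrix.conjTranspose_map (mixedSpaceEvalReal K w) (fun _ => rfl)]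
    exact posDef_mul_mul_conjTranspose (hR w)
      ((Units.isUnit g).map (mixedSpaceEvalReal K w).mapMatrix)
  · rw [Matrix.map_mul, Matrix.map_mul,
      Matrix.conjTranspose_map (mixedSpaceEvalComplex K w) (fun _ => rfl)]
    exact posDef_mul_mul_conjTranspose (hC w)
      ((Units.isUnit g).map (mixedSpaceEvalComplex K w).mapMatrix)

/-- **(iv) Convexity of the cone**: the matrices over `K_∞` which are positive definite at every
place form a convex subset of the real vector space `M_n(K_∞)` (evaluation at a place is
`ℝ`-linear and `a H_w + b H'_w` is positive definite for `a, b > 0`). [cite: Borel1969, §12] -/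
private theorem coneModel_convex :
    Convex ℝ {H : Matrix (Fin n) (Fin n) (mixedSpace K) |
      (∀ w, (H.map (mixedSpaceEvalReal K w)).PosDef) ∧
        ∀ w, (H.map (mixedSpaceEvalComplex K w)).PosDef} := by
  refine convex_iff_forall_pos.mpr ?_
  rintro X ⟨hXR, hXC⟩ Y ⟨hYR, hYC⟩ a b ha hb -
  refine ⟨fun w => ?_, fun w => ?_⟩
  · rw [Matrix.map_add _ (map_add _), Matrix.map_smul (mixedSpaceEvalReal K w) a (fun _ => rfl),
      Matrix.map_smul (mixedSpaceEvalReal K w) b (fun _ => rfl)]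
    exact posDef_smul_add_smul (hXR w) (hYR w) ha hb
  · rw [Matrix.map_add _ (map_add _),
      Matrix.map_smul (mixedSpaceEvalComplex K w) a (fun _ => rfl),
      Matrix.map_smul (mixedSpaceEvalComplex K w) b (fun _ => rfl)]
    exact posDef_smul_add_smul (hXC w) (hYC w) ha hb

end MixedSpace

/-! ### The registered stub -/

/-- **Stub CM — the cone model of `GL_n(K ⊗ ℝ)`**: on self-adjoint matrices over
`mixedSpace K = ℝ^{r₁} × ℂ^{r₂}` which are positive definite at every place, `g • H = g H gᴴ`;
(i) transitivity (Cholesky place by place), (ii) the stabiliser of `1` is `K_∞ = Kinf n K`,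
(iii) invariance of the cone, (iv) convexity of the cone. [cite: Borel1969, §12] -/
theorem stub_coneModel (n : ℕ) (K : Type) [Field K] [NumberField K] :
    (∀ H : Matrix (Fin n) (Fin n) (mixedSpace K),
      (∀ w, (H.map (mixedSpaceEvalReal K w)).PosDef) →
      (∀ w, (H.map (mixedSpaceEvalComplex K w)).PosDef) →
        ∃ g : GL (Fin n) (mixedSpace K),
          (g : Matrix (Fin n) (Fin n) (mixedSpace K)) * (g : Matrix (Fin n) (Fin n) (mixedSpace K))ᴴ = H) ∧
    (∀ g : GL (Fin n) (mixedSpace K),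
      (g : Matrix (Fin n) (Fin n) (mixedSpace K)) * (g : Matrix (Fin n) (Fin n) (mixedSpace K))ᴴ = 1 ↔
        g ∈ Kinf n K) ∧
    (∀ (g : GL (Fin n) (mixedSpace K)) (H : Matrix (Fin n) (Fin n) (mixedSpace K)),
      (∀ w, (H.map (mixedSpaceEvalReal K w)).PosDef) →
      (∀ w, (H.map (mixedSpaceEvalComplex K w)).PosDef) →
        (∀ w, (((g : Matrix (Fin n) (Fin n) (mixedSpace K)) * H *
          (g : Matrix (Fin n) (Fin n) (mixedSpace K))ᴴ).map (mixedSpaceEvalReal K w)).PosDef) ∧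
        (∀ w, (((g : Matrix (Fin n) (Fin n) (mixedSpace K)) * H *
          (g : Matrix (Fin n) (Fin n) (mixedSpace K))ᴴ).map (mixedSpaceEvalComplex K w)).PosDef)) ∧
    Convex ℝ {H : Matrix (Fin n) (Fin n) (mixedSpace K) |
      (∀ w, (H.map (mixedSpaceEvalReal K w)).PosDef) ∧
        ∀ w, (H.map (mixedSpaceEvalComplex K w)).PosDef} :=
  ⟨coneModel_transitive n K, coneModel_stabilizer n K, coneModel_invariant n K,
    coneModel_convex n K⟩

end Summit.Langlands.Langlands.Theorems.HeckeEigenvalueField.Res
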